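import Literature.AnabelianGeometry.SemiGraphs.PSCSmoothProperGenuineRank
import Literature.AnabelianGeometry.SemiGraphs.PSCCoveringDatumSturdyAt
import Literature.AnabelianGeometry.SemiGraphs.PSCSturdyCover
import Literature.AnabelianGeometry.SemiGraphs.ProSigmaSubquotients
import HarnessLib

/-!
# [CombGC] Rmk. 1.1.5 "sturdy characteristic cover" at the genuine smooth-proper origin

Mochizuki, *A combinatorial version of the Grothendieck conjecture* [CombGC], Tohoku Math. J. **59**
(2007), §1, Def. 1.1 (ii) "sturdy" / Remark 1.1.5 p. 8 ("sturdy ⟺ every component has genus ≥ 2";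
"there always exists a characteristic open subgroup `H ⊆ Π_G` such that every `Π_G`-covering `G′ → G`
with `Π_{G′} ⊆ H` is sturdy"), typed by abc-iut-w5-d188 as the predicates `IsSturdyAt`,
`SturdyAtTopIffSturdy`, `SturdyCharacteristicCover` and the origin-level `SturdyCoverHolds Ω`
(`PSCSturdyCover.lean`). [cite: MochizukiCombGC2007, Rmk 1.1.5 p.8]

PROOF-ONLY file (abc-iut cell, layer L3, [CombGC] non-vacuity programme; seat abc-iut-w5-d195 gen 6;
sequel of `PSCSmoothProperGenuineRank.lean`).  At a GENUINE smooth-proper datum (profinite `Π`, one vertex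
`Π_v = Π`, no edges, a pro-`Σ` completion `ι : S_g → Π`, `g ≥ 2 = genus(v)`):

* `isSturdyAt_top_of_smoothProperGenuine` — Def. 1.1 (ii) "sturdy" at the trivial level: the only
  verticial subgroup is `Π`, and its unramified abelianisation `Π ⧸ closure[Π,Π]` is the pro-`Σ`
  completion of `ℤ^{2g}`, `2g > 2`;
* `isSturdyAt_of_smoothProperGenuine` — the same at every open level `U` (through abc-iut-w5-d226's bridge
  `isSturdyAt_restrict_top_iff` and covering-closedness `restrict_smoothProperGenuine`);
* `sturdyCoverHolds_of_smoothProperGenuine` — **`SturdyCoverHolds Ω`** at every origin of genuine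
  smooth-proper data (`H := Π` itself);
* `exists_smoothProperGenuineOrigin_inputs_hold` — at the covering-closed genuine smooth-proper origin
  (inhabited by `Ŝ₂`) the WHOLE origin-level input family of the tree's [CombGC] Prop 1.2 / Thm 1.6 (iii)
  derivations — `RestrictBDOfPSCTypeHolds`, `SturdyCoverHolds`, `UnrVerticialCharacterizationHolds'`,
  `UnrVertAbOfRankHolds`, profiniteness — holds together (the non-vacuity item named by abc-iut-f-165).

Consistency / non-vacuity evidence at genuine one-component data; not the printed theorems; nothing here
takes a side on [IUTchIII] Cor. 3.12.
-/

noncomputable section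

namespace Literature.AnabelianGeometry.SemiGraphs

namespace PSCDatum

open scoped Pointwise
open Literature.Topology.FourManifolds (SurfaceGroup)
open SemiGraphOfAnabelioids (IsProSigmaCompletion)
open Literature.IUT.HodgeTheaters (profiniteCompletion toCompletion)

universe u

variable {P : Type u} [Group P] [TopologicalSpace P] [IsTopologicalGroup P]

/-! ### Sturdiness at the trivial level -/

omit [IsTopologicalGroup P] in
/-- With `Π_v = Π` for all `v`, the only verticial subgroup of `Π_{G_Π} = Π` is `Π`.
[cite: MochizukiCombGC2007, Def 1.1(ii) p.6] -/
theorem eq_top_of_isVerticialIn_top (G : PSCDatum P) (hV : ∀ v, G.vertGp v = ⊤) {A : Subgroup P}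
    (hA : G.IsVerticialIn ⊤ A) : A = ⊤ := by
  obtain ⟨B, ⟨v, γ, rfl⟩, rfl⟩ := hA
  rw [hV, top_inf_eq]
  exact top_le_iff.mp fun x _ => by
    rw [Subgroup.mem_pointwise_smul_iff_inv_smul_mem]; exact Subgroup.mem_top _

/-- At such a datum the level-`Π` kernel `unrVertAbKerAt ⊤ A` of a verticial `A` is `Ker(Π ↠ M^unr)`.
[cite: MochizukiCombGC2007, Def 1.1(ii) p.7] -/
theorem unrVertAbKerAt_top_eq_unrAbKer (G : PSCDatum P) {A : Subgroup P} (hA : A = ⊤) :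
    G.unrVertAbKerAt ⊤ A = G.unrAbKer := by
  have hW : G.unrVertAt ⊤ A = ⊤ := by rw [unrVertAt_top, hA, top_sup_eq]
  rw [unrVertAbKerAt, hW, unrKerIn_top, unrAbKer]

/-- **Def. 1.1 (ii) "sturdy" at the trivial level of a genuine smooth-proper datum** (`g ≥ 2`): the
unramified abelianisation of the unique verticial subgroup `Π` is `Π ⧸ closure [Π,Π]`, the pro-`Σ`
completion of `S_g^{ab} ≅ ℤ^{2g}` with `2g > 2`. [cite: MochizukiCombGC2007, Rmk 1.1.5 p.8] -/
theorem isSturdyAt_top_of_smoothProperGenuine [T2Space P] (G : PSCDatum P) [IsEmpty G.graph.N]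
    [IsEmpty G.graph.C] (hV : ∀ v, G.vertGp v = ⊤) {g : ℕ} (hg : 2 ≤ g) (ι : SurfaceGroup g →* P)
    (hι : IsProSigmaCompletion G.Sigma ι) : G.IsSturdyAt ⊤ := by
  intro A hA _
  have hAtop : A = ⊤ := G.eq_top_of_isVerticialIn_top hV hA
  set W : Subgroup P := G.unrVertAt ⊤ A with hWdef
  have hW : W = ⊤ := by rw [hWdef, unrVertAt_top, hAtop, top_sup_eq]
  -- `ι` co-restricted to `W = ⊤`, a pro-`Σ` completion of `W`
  have hmem : ∀ x, ι x ∈ W := fun x => by rw [hW]; exact Subgroup.mem_top _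
  let ιW : SurfaceGroup g →* W := ι.codRestrict W hmem
  let e : W ≃* P := (MulEquiv.subgroupCongr hW).trans Subgroup.topEquiv
  have he_apply : ∀ x : W, e x = (x : P) := fun _ => rfl
  have he : Continuous e := by
    have : (e : W → P) = Subtype.val := funext he_apply
    rw [this]; exact continuous_subtype_val
  have hes : Continuous e.symm := by
    have : (e.symm : P → W) = fun p => ⟨p, hW ▸ Subgroup.mem_top p⟩ := by
      funext p
      apply Subtype.ext
      change ((e (e.symm p)) : P) = p
      rw [MulEquiv.apply_symm_apply]
    rw [this]
    exact continuous_id.subtype_mk _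
  have hιW : IsProSigmaCompletion G.Sigma ιW :=
    IsProSigmaCompletion.of_target_mulEquiv hι e he hes fun _ => rfl
  -- the kernel is the closure of `ιW([S_g,S_g])`
  set K : Subgroup W := (G.unrVertAbKerAt ⊤ A).subgroupOf W with hKdef
  have hK : (K : Set W) = closure (ιW '' ((commutator (SurfaceGroup g) : Subgroup _) : Set _)) := by
    rw [hKdef, Subgroup.coe_subgroupOf, G.unrVertAbKerAt_top_eq_unrAbKer hAtop,
      Topology.IsEmbedding.subtypeVal.closure_eq_preimage_closure_image, Set.image_image]
    change Subtype.val ⁻¹' (G.unrAbKer : Set P) = Subtype.val ⁻¹' closure ((fun x => ι x) '' _)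
    rw [G.unrAbKer_eq_closure_commutator,
      ← IsProSigmaCompletion.topologicalClosure_map_commutator_eq hι.dense,
      Subgroup.topologicalClosure_coe, Subgroup.coe_map]
  have hφ := IsProSigmaCompletion.quotientMap_of_coe_eq_closure hιW (commutator (SurfaceGroup g)) K hK
  have hle : commutator (SurfaceGroup g) ≤ K.comap ιW :=
    IsProSigmaCompletion.le_comap_of_image_subset
      (IsProSigmaCompletion.image_subset_of_coe_eq_closure hK)
  obtain ⟨eab⟩ := nonempty_mulEquiv_abelianization_surfaceGroup (n := 2 * g) rfl
  exact ⟨2 * g, by omega, (QuotientGroup.map _ K ιW hle).comp eab.toMonoidHom,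
    IsProSigmaCompletion.of_comp_mulEquiv eab (fun _ => rfl) hφ⟩

/-! ### Sturdiness at every open level, and Rmk. 1.1.5 -/

/-- **Def. 1.1 (ii) "sturdy" at every open level of a genuine smooth-proper datum**: `G_U` is again a
genuine smooth-proper datum (`restrict_smoothProperGenuine`), sturdy at its trivial level, and
abc-iut-w5-d226's bridge `isSturdyAt_restrict_top_iff` transports this to `G` at level `U`.
[cite: MochizukiCombGC2007, Rmk 1.1.5 p.8] -/
theorem isSturdyAt_of_smoothProperGenuine [CompactSpace P] [T2Space P] [TotallyDisconnectedSpace P]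
    (G : PSCDatum P) [IsEmpty G.graph.N] [IsEmpty G.graph.C] (hV : ∀ v, G.vertGp v = ⊤)
    (v₀ : G.graph.V) (hv : ∀ w, w = v₀) {g : ℕ} (hg : 2 ≤ g) (ι : SurfaceGroup g →* P)
    (hι : IsProSigmaCompletion G.Sigma ι) (hgen : ∀ v, G.genus v = g) (U : Subgroup P)
    (hU : IsOpen (U : Set P)) : G.IsSturdyAt U := by
  haveI : U.FiniteIndex := IsProSigma.finiteIndex_of_isOpen G.proSigma U hU
  obtain ⟨hN', hC', hV', -, g', ι', hg', hι', -⟩ := G.restrict_smoothProperGenuine U hU hV v₀ hv hg ι hι hgen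
  haveI := hN'; haveI := hC'
  exact (G.isSturdyAt_restrict_top_iff U hU).mp
    ((G.restrict U hU).isSturdyAt_top_of_smoothProperGenuine hV' hg' ι' hι')

/-- **[CombGC] Rmk. 1.1.5 (`SturdyCoverHolds`) at every origin of genuine smooth-proper data**: Def. 1.1
(ii) "sturdy" holds at the trivial level and so does `IsSturdy` (genus `≥ 2`), and `H := Π_G` is a
characteristic open subgroup below which every covering is sturdy. [cite: MochizukiCombGC2007, Rmk 1.1.5 p.8] -/
theorem sturdyCoverHolds_of_smoothProperGenuine (Ω : PSCOrigin.{u})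
    (hΩ : ∀ ⦃Q : Type u⦄ [Group Q] [TopologicalSpace Q] [IsTopologicalGroup Q] (G : PSCDatum Q),
      Ω.IsOfPSCType G → CompactSpace Q ∧ T2Space Q ∧ TotallyDisconnectedSpace Q ∧ IsEmpty G.graph.N ∧
        IsEmpty G.graph.C ∧ (∀ v, G.vertGp v = ⊤) ∧ (∃ v₀ : G.graph.V, ∀ w, w = v₀) ∧
        ∃ (g : ℕ) (ι : SurfaceGroup g →* Q), 2 ≤ g ∧ IsProSigmaCompletion G.Sigma ι ∧ ∀ v, G.genus v = g) :
    SturdyCoverHolds Ω := by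
  intro Q _ _ _ G hG
  obtain ⟨hc, ht, hd, hN, hC, hV, ⟨v₀, hv⟩, g, ι, hg, hι, hgen⟩ := hΩ G hG
  have hsturdy : G.IsSturdy := fun v => by rw [hgen]; exact hg
  refine ⟨iff_of_true (G.isSturdyAt_top_of_smoothProperGenuine hV hg ι hι) hsturdy, ⊤, ?_, inferInstance,
    fun U hU _ => G.isSturdyAt_of_smoothProperGenuine hV v₀ hv hg ι hι hgen U hU⟩
  rw [Subgroup.coe_top]; exact isOpen_univ

/-- **At the covering-closed GENUINE smooth-proper origin (inhabited by `Ŝ₂`) the whole origin-level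
input family of the tree's [CombGC] Prop 1.2 / Thm 1.6 (iii) derivations holds together**:
`RestrictBDOfPSCTypeHolds ∧ SturdyCoverHolds ∧ UnrVerticialCharacterizationHolds' ∧ UnrVertAbOfRankHolds`
and profiniteness of every datum (with F-0438 / F-0459 / F-0461 from the smooth-proper instance forms).
Non-vacuity at genuine data of the hypotheses of `unrVerticialIff_holds_of_inputs'`,
`verticialSeparatingCoverings_of_origin'`, `prop12_verticial_unr_of_origin…` (abc-iut-w4-d052,
abc-iut-f-165, abc-iut-f-166). [cite: MochizukiCombGC2007, Rmk 1.1.5 p.8] -/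
theorem exists_smoothProperGenuineOrigin_inputs_hold :
    ∃ Ω : PSCOrigin.{0},
      (∃ G : PSCDatum (profiniteCompletion (SurfaceGroup 2)), Ω.IsOfPSCType G ∧ G.IsSturdy ∧
          (∀ v, G.vertGp v = ⊤ ∧ G.genus v = 2)) ∧
      RestrictBDOfPSCTypeHolds Ω ∧ SturdyCoverHolds Ω ∧ UnrVerticialCharacterizationHolds' Ω ∧
      UnrVertAbOfRankHolds Ω ∧
      (∀ ⦃Q : Type⦄ [Group Q] [TopologicalSpace Q] [IsTopologicalGroup Q] (G : PSCDatum Q),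
        Ω.IsOfPSCType G → CompactSpace Q ∧ T2Space Q ∧ TotallyDisconnectedSpace Q) ∧
      CommensurableTerminalityHolds Ω ∧ OpenInterDeterminesComponentHolds Ω ∧ UnrVerticialIffHolds Ω := by
  let Ω : PSCOrigin.{0} :=
    ⟨fun {Q} _ _ G => ∃ (_ : IsTopologicalGroup Q), CompactSpace Q ∧ T2Space Q ∧
      TotallyDisconnectedSpace Q ∧ IsEmpty G.graph.N ∧ IsEmpty G.graph.C ∧ (∀ v, G.vertGp v = ⊤) ∧
      (∃ v₀ : G.graph.V, ∀ w, w = v₀) ∧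
      ∃ (g : ℕ) (ι : SurfaceGroup g →* Q), 2 ≤ g ∧ IsProSigmaCompletion G.Sigma ι ∧ ∀ v, G.genus v = g⟩
  have hΩ : ∀ ⦃Q : Type⦄ [Group Q] [TopologicalSpace Q] (G : PSCDatum Q), Ω.IsOfPSCType G →
      IsEmpty G.graph.N ∧ IsEmpty G.graph.C ∧ (∀ v, G.vertGp v = ⊤) ∧ ∃ v₀ : G.graph.V, ∀ w, w = v₀ := by
    intro Q _ _ G hG
    obtain ⟨_, -, -, -, hN, hC, hV, hv, -⟩ := hG
    exact ⟨hN, hC, hV, hv⟩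
  have hΩr : ∀ ⦃Q : Type⦄ [Group Q] [TopologicalSpace Q] [IsTopologicalGroup Q] (G : PSCDatum Q),
      Ω.IsOfPSCType G → T2Space Q ∧ IsEmpty G.graph.N ∧ IsEmpty G.graph.C ∧ (∀ v, G.vertGp v = ⊤) ∧
        ∃ (g : ℕ) (ι : SurfaceGroup g →* Q), IsProSigmaCompletion G.Sigma ι ∧ ∀ v, G.genus v = g := by
    intro Q _ _ _ G hG
    obtain ⟨_, -, ht, -, hN, hC, hV, -, g, ι, -, hι, hgen⟩ := hG
    exact ⟨ht, hN, hC, hV, g, ι, hι, hgen⟩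
  have hΩs : ∀ ⦃Q : Type⦄ [Group Q] [TopologicalSpace Q] [IsTopologicalGroup Q] (G : PSCDatum Q),
      Ω.IsOfPSCType G → CompactSpace Q ∧ T2Space Q ∧ TotallyDisconnectedSpace Q ∧ IsEmpty G.graph.N ∧
        IsEmpty G.graph.C ∧ (∀ v, G.vertGp v = ⊤) ∧ (∃ v₀ : G.graph.V, ∀ w, w = v₀) ∧
        ∃ (g : ℕ) (ι : SurfaceGroup g →* Q), 2 ≤ g ∧ IsProSigmaCompletion G.Sigma ι ∧ ∀ v, G.genus v = g := by
    intro Q _ _ _ G hG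
    obtain ⟨_, h⟩ := hG
    exact h
  -- the genuine datum `Ŝ₂`
  let G : PSCDatum (profiniteCompletion (SurfaceGroup 2)) :=
    { Sigma := {p | p.Prime}
      sigma_prime := fun _ hp => hp
      sigma_nonempty := ⟨2, Nat.prime_two⟩
      graph := { V := Unit, N := Empty, C := Empty, nodeEnds := Empty.elim, cuspEnd := Empty.elim }
      vertGp := fun _ => ⊤
      nodeGp := Empty.elim
      cuspGp := Empty.elim
      genus := fun _ => 2
      isClosed_vertGp := fun _ => by rw [Subgroup.coe_top]; exact isClosed_univ
      isClosed_nodeGp := fun e => e.elim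
      isClosed_cuspGp := fun c => c.elim
      nodeGp_le := fun e => e.elim
      cuspGp_le := fun c => c.elim
      proSigma := ⟨fun _ _ _ hp _ => hp⟩ }
  have hι : IsProSigmaCompletion G.Sigma (toCompletion (SurfaceGroup 2)) :=
    IsProSigmaCompletion.isProSigmaCompletion_toCompletion (SurfaceGroup 2)
  have hG : Ω.IsOfPSCType G :=
    ⟨inferInstance, inferInstance, inferInstance, inferInstance, inferInstanceAs (IsEmpty Empty),
      inferInstanceAs (IsEmpty Empty), fun _ => rfl, ⟨(), fun _ => rfl⟩, 2, toCompletion (SurfaceGroup 2),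
      le_rfl, hι, fun _ => rfl⟩
  refine ⟨Ω, ⟨G, hG, fun _ => le_rfl, fun _ => ⟨rfl, rfl⟩⟩, ?_,
    sturdyCoverHolds_of_smoothProperGenuine Ω hΩs,
    unrVerticialCharacterizationHolds'_of_smoothProper Ω hΩ,
    unrVertAbOfRankHolds_of_smoothProperGenuine Ω hΩr, ?_,
    commensurableTerminalityHolds_of_smoothProper Ω hΩ,
    openInterDeterminesComponentHolds_of_smoothProper Ω hΩ, unrVerticialIffHolds_of_smoothProper Ω hΩ⟩
  · -- RestrictBDOfPSCTypeHolds
    intro Q _ _ _ H hH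
    obtain ⟨_, hc, ht, hd, hN, hC, hV, ⟨v₀, hv⟩, g, ι, hg, hιH, hgen⟩ := hH
    refine ⟨H.chosenBranchData, fun U _ hU => ?_⟩
    rw [restrictBD_chosen]
    haveI : CompactSpace U := isCompact_iff_compactSpace.mp (U.isClosed_of_isOpen hU).isCompact
    obtain ⟨hN', hC', hV', hv', g', ι', hg', hι', hgen'⟩ :=
      H.restrict_smoothProperGenuine U hU hV v₀ hv hg ι hιH hgen
    exact ⟨inferInstance, inferInstance, inferInstance, inferInstance, hN', hC', hV', hv', g', ι', hg', hι',
      hgen'⟩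
  · intro Q _ _ _ H hH
    obtain ⟨_, hc, ht, hd, -⟩ := hH
    exact ⟨hc, ht, hd⟩

end PSCDatum

end Literature.AnabelianGeometry.SemiGraphs

end
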